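import Literature.MathematicalPhysics.QuantumFieldTheory.Balaban1983to89.B9Eq3132CTInputs

/-!
# `Balaban1983to89.B9Eq3132ScalarIndex` — [B9] (3.132) p. 422 for MATRIX-VALUED kernels: the whole printed leaf
# `B9.Stmt3132Printed` by the Combes–Thomas route run on the SCALAR INDEX SET I = 𝔅 × basis(𝔤) of the cell's written
# repair, i.e. over an arbitrary finite index fibred over the coarse sites

T. Bałaban, *Propagators for lattice gauge theories in a background field*, Commun. Math. Phys. **99** (1985) 389–434
[`Balaban1985BackgroundPropagators`, "B9"]; [4] = T. Bałaban, *Propagators and renormalization transformations for lattice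
gauge theories. II*, Commun. Math. Phys. **96** (1984) 223–250 [`Balaban1984PropagatorsII`].

statement-level skeleton of published theorems with citation tags; proofs where landed; nothing here is a claim about the
Yang–Mills mass gap

THE PRINTED LOCUS (verbatim, p. 422 [PDF 34]).  *"We have |(QGQ\*)^{−1}(y, y′)| ≤ O(1)(L^jη)^{−2}(L^{j′}η)^{−d}e^{−δ₁d(y,y′)} for
y ∈ Λ_j, y′ ∈ Λ_{j′}, (3.132) and the same for the operator with G₁ instead of G."*  Here (QGQ\*)^{−1}(y, y′) ∈ End(𝔤) and |·| is
the operator norm on 𝔤 (the kernel convention of [4] (2.150)); GAPS G-B9-15.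

THE POINT.  Row 26 of the N06 knit is inhabited by `B9Eq3132Whole.stmt3132Printed_of_coercive` (p462308) and reduced by
`B9Eq3132CTInputs` (p472447) to coercivity + decay of a normalised matrix `S i U : Matrix (geo i).Site (geo i).Site ℝ` plus the
dictionary `B9Eq3132Whole.InvNormalised` (|K(U)(y, y′)| ≦ w(y)w(y′)|(S U)⁻¹(y, y′)|).  That matrix is SCALAR on the coarse sites —
the case dim 𝔤 = 1.  The cell's written repair (`HOME/b2b-balaban-r1/QGQ-inverse-proof.md` §3: *"S̃ is a real symmetric positive
matrix on the finite index set I := 𝔅 × {basis of 𝔤}"*; §4.5: *"passing to the scalar index set … costs a factor n_𝔤"*; §6.2: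
*"‖S̃⁻¹(c, c′)‖ ≤ (2n_𝔤∕γ)e^{−κd(c,c′)} blockwise"*) runs the finite Combes–Thomas argument `QGQInverse.inverse_decay` on the index
set I with the pseudo-metric d(c, c′) lifted to I (zero between basis indices at the same bond — allowed), and reads the
End(𝔤)-valued kernel entry off the BLOCK of S̃⁻¹ over the two fibres.  For a non-abelian instance (def-Y's M_N(ℂ)-valued letters) the
scalar shape is not the one the construction produces; THIS FILE types row 26 over an ARBITRARY FINITE INDEX `n i` FIBRED OVER
THE COARSE SITES (`π i : n i → (geo i).Site`, fibre cardinality ≦ F), reusing — not restating — the scalar modules: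

* §1 `geoComap g π` — the (2.46)-geometry pulled back along `π` (sites := the index, d(a, b) := d(πa, πb), scale := scale ∘ π;
  `Lʲη`, L, η, M unchanged): the Combes–Thomas inputs over the index ARE `B9Eq3132Whole.CTInputs c35 (geoComap-family) bg S`
  and `B9Eq3132CTInputs.CoerciveUnder ∕ DecayUnder` likewise (no new schema).  `InvNormalisedIdx K π S w` — the blockwise
  dictionary |K(U)(y, y′)| ≦ w(y)w(y′)·Σ_{a∈π⁻¹y}Σ_{b∈π⁻¹y′}|(S U)⁻¹(a, b)| (operator norm of a block ≦ the sum of its scalar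
  entries); `invNormalisedIdx_id_iff`: at `π = id` it is `InvNormalised` (conservative extension).
* §2 `rowSum261_geoComap` — [4] (2.61) lifts to the index with constant F·c; `ineq3132_of_coercive_idx` — ONE member, ONE U:
  coercivity of `S` on the index, (e^{κd(πa,πb)} − 1)-weighted row∕column sums ≦ ρ < γ, the blockwise dictionary, the weights
  transfer and fibres ≦ F give `B9.Ineq3132 d K ((γ − ρ)⁻¹·F²·A) (κ − ε) U` (`QGQInverse.inverse_decay` on the index).
* §3 ★ `stmt3132Printed_of_coercive_idx` — THE WHOLE PRINTED LEAF over any family from `CTInputs` on the index (for S and S₁),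
  `InvNormalisedIdx` ×2, the weights transfer, the carrier facts; O(1) := ((γ − ρ)⁻¹ + (γ′ − ρ′)⁻¹)·(F² + 1)·A, δ₁ := ½min κ κ′.
* §4 ★ `stmt3132Printed_geo9Y_of_coercive_decay_idx` — AT THE RECORD GEOMETRY `geo9Y`, symmetric normalisation: from SIX located
  binders (`CoerciveUnder`∕`DecayUnder` on the index for S, S₁; `InvNormalisedIdx` ×2) and the fibre bound — (2.61) on the index
  from `rowSum261_geo9Y`, everything geometric discharged (p467804∕p468507∕p472447).  At def-Y's SU(N) instance the intended
  index is `IBondY x × (real coordinates of M_N(ℂ))`, F = 2N², `S x U` = the real matrix of W^{1/2}D⁻¹(QGQ\*)(U)D⁻¹W^{1/2}.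

HONEST SCOPE.  Nothing of print is asserted; coercivity and decay of the normalised matrices REMAIN HYPOTHESES (located: Thm 3.11
p. 416 ∕ Thm 3.3 p. 399 + [4] (2.60)); the blockwise dictionary is a located hypothesis shape (the instance discharges it).  Value:
the row-26 residual binders in a shape a non-abelian instance can meet — kernel-checked bookkeeping, NOT a node discharge, NOT
summit progress; one finite lattice programme; nothing continuum, nothing about the mass gap.  Cell `pub-ymgap` (HUMAN RULING
D-0062), Track A node N06 [B9], N06-ASSIGNMENT v1 row 26 (bundle F4), seat `pub-ymgap-dag-n06-i` gen 3, 2026-08-26.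
-/

namespace Literature.MathematicalPhysics.QuantumFieldTheory.Balaban1983to89.B9Eq3132ScalarIndex

open QGQInverse (Coercive inverse_decay)
open B9Eq3132Whole (CTInputs InvNormalised WeightsTransfer exp_growth_mul_decay ineq3132_mono weighted_term_mono)
open B9Eq3132CTInputs (CoerciveUnder DecayUnder ctInputs_of_coercive_decay)
open B9Ineq349Whole (RowSum261)

noncomputable section

/-! ## §1 The geometry pulled back to the index, and the blockwise dictionary -/

section Comap

variable {n : Type}

/-- **THE (2.46)-GEOMETRY PULLED BACK TO A FINITE INDEX FIBRED OVER THE COARSE SITES** (the written repair's I = 𝔅 × basis(𝔤) with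
d((c, α), (c′, β)) := d(c, c′)): sites := the index `n`, distance d(πa, πb), scale j(πa) (so `Lʲη` at a is that of πa), L, η, k, M and
the argument ∕ cut-off carriers unchanged (their support predicates read through π).  A pulled-back pseudo-metric is a pseudo-metric.
[cite: Balaban1984PropagatorsII, (2.46) p.231 (the distance), dictionary; Balaban1985BackgroundPropagators, (3.132) p.422 (𝔤-valued kernels)] -/
abbrev geoComap (g : B9.Geometry) (π : n → g.Site) : B9.Geometry where
  Site := n
  scale := fun a => g.scale (π a)
  dist := fun a b => g.dist (π a) (π b)
  k := g.k
  eta := g.eta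
  L := g.L
  M := g.M
  Loc := g.Loc
  suppIn := fun lam a => g.suppIn lam (π a)
  suppInT := fun lam a => g.suppInT lam (π a)
  supNorm := g.supNorm
  l2Norm := g.l2Norm
  wNorm := g.wNorm
  holder := g.holder
  Cut := g.Cut
  cutIn := fun ζ a => g.cutIn ζ (π a)
  cutInT := fun ζ a => g.cutInT ζ (π a)
  cutH := g.cutH
  cutSup := g.cutSup
  suppInT_of_suppIn := fun lam a h => g.suppInT_of_suppIn lam (π a) h
  cutInT_of_cutIn := fun ζ a h => g.cutInT_of_cutIn ζ (π a) h

/-- the pulled-back distance is d(πa, πb). [cite: Balaban1984PropagatorsII, (2.46) p.231, bookkeeping] -/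
theorem geoComap_dist (g : B9.Geometry) (π : n → g.Site) (a b : n) : (geoComap g π).dist a b = g.dist (π a) (π b) := rfl

/-- the pulled-back scale length is `Lʲη` at πa. [cite: Balaban1985BackgroundPropagators, (3.41) p.397 («Lʲη»), bookkeeping] -/
theorem geoComap_len (g : B9.Geometry) (π : n → g.Site) (a : n) : (geoComap g π).len a = g.len (π a) := rfl

/-- the pulled-back M is M. [cite: Balaban1984PropagatorsII, (2.1)–(2.2) p.224 (M), bookkeeping] -/
theorem geoComap_M (g : B9.Geometry) (π : n → g.Site) : (geoComap g π).M = g.M := rfl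

variable {g : B9.Geometry} {B : B9.Backgrounds} [Fintype n] [DecidableEq n] [DecidableEq g.Site]

/-- **THE BLOCKWISE UN-NORMALISING DICTIONARY** (located hypothesis shape; the written repair §6.2 read on the index I = 𝔅 × basis(𝔤)):
the End(𝔤)-valued kernel entry of (QGQ\*)^{−1}(U) (or (QG₁Q\*)^{−1}(U)) at (y, y′), in operator norm, is dominated by w(y)·w(y′) times the
SUM of the absolute scalar entries of `(S U)⁻¹` over the block π⁻¹y × π⁻¹y′ of the normalised matrix `S U` on the index (the operator
norm of a block is at most the sum of its entries; N = diag w).  Nothing of print; the dictionary between the operator and a finite real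
matrix. [cite: Balaban1985BackgroundPropagators, (3.132) p.422 + (3.126) p.420 (the operator (QGQ\*)^{−1}; dictionary shape)] -/
def InvNormalisedIdx (K : B9.SiteKernel g B) (π : n → g.Site) (S : B.Cfg → Matrix n n ℝ) (w : g.Site → ℝ) : Prop :=
  ∀ (U : B.Cfg) (y y' : g.Site), |K.ker U y y'| ≤ w y * w y' *
    ∑ a ∈ Finset.univ.filter (fun a => π a = y), ∑ b ∈ Finset.univ.filter (fun b => π b = y'), |(S U)⁻¹ a b|

/-- At the identity fibration (dim 𝔤 = 1) the blockwise dictionary IS `B9Eq3132Whole.InvNormalised` — the generalisation is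
conservative. [cite: Balaban1985BackgroundPropagators, (3.132) p.422 (bookkeeping)] -/
theorem invNormalisedIdx_id_iff [Fintype g.Site] (K : B9.SiteKernel g B) (S : B.Cfg → Matrix g.Site g.Site ℝ)
    (w : g.Site → ℝ) : InvNormalisedIdx K id S w ↔ InvNormalised K S w := by
  have hfib : ∀ y : g.Site, (Finset.univ.filter fun a : g.Site => id a = y) = {y} := by
    intro y
    ext a
    simp
  unfold InvNormalisedIdx InvNormalised
  simp only [hfib, Finset.sum_singleton]

end Comap

/-! ## §2 (2.61) on the index, and (3.132) at one member and one configuration from the index data -/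

section OneU

variable {n : Type} [Fintype n] {g : B9.Geometry} {B : B9.Backgrounds} [DecidableEq g.Site]

/-- Sums over the index of a function of the coarse site: Σ_b f(πb) ≦ F·Σ_{y′} f(y′) for f ≧ 0 and fibres of cardinality ≦ F.
[cite: Balaban1984PropagatorsII, Lemma 2.1 (2.61) p.234 (bookkeeping: the fibre count n_𝔤)] -/
theorem sum_comp_le_of_fibre [Fintype g.Site] (π : n → g.Site) {F : ℝ}
    (hF : ∀ y : g.Site, (((Finset.univ.filter fun a : n => π a = y).card : ℕ) : ℝ) ≤ F) (f : g.Site → ℝ)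
    (hf : ∀ y, 0 ≤ f y) : ∑ b : n, f (π b) ≤ F * ∑ y : g.Site, f y := by
  rw [← Finset.sum_fiberwise' Finset.univ π f, Finset.mul_sum]
  refine Finset.sum_le_sum fun y _ => ?_
  rw [Finset.sum_const, nsmul_eq_mul]
  exact mul_le_mul_of_nonneg_right (hF y) (hf y)

/-- A double sum over two fibres of terms each ≦ c (c ≧ 0) is ≦ F·F·c when fibres have cardinality ≦ F.
[cite: Balaban1985BackgroundPropagators, (3.132) p.422 (bookkeeping: the block of n_𝔤 × n_𝔤 scalar entries)] -/
theorem fibre_double_sum_le (π : n → g.Site) {F c : ℝ}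
    (hF : ∀ y : g.Site, (((Finset.univ.filter fun a : n => π a = y).card : ℕ) : ℝ) ≤ F) (hc : 0 ≤ c)
    (f : n → n → ℝ) (y y' : g.Site)
    (hf : ∀ a ∈ Finset.univ.filter (fun a : n => π a = y), ∀ b ∈ Finset.univ.filter (fun b : n => π b = y'), f a b ≤ c) :
    ∑ a ∈ Finset.univ.filter (fun a : n => π a = y), ∑ b ∈ Finset.univ.filter (fun b : n => π b = y'), f a b ≤ F * F * c := by
  have hF0 : 0 ≤ F := le_trans (Nat.cast_nonneg _) (hF y)
  have hinner : ∀ a ∈ Finset.univ.filter (fun a : n => π a = y),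
      ∑ b ∈ Finset.univ.filter (fun b : n => π b = y'), f a b ≤ F * c := by
    intro a ha
    refine le_trans (Finset.sum_le_card_nsmul _ _ c (hf a ha)) ?_
    rw [nsmul_eq_mul]
    exact mul_le_mul_of_nonneg_right (hF y') hc
  refine le_trans (Finset.sum_le_card_nsmul _ _ (F * c) hinner) ?_
  rw [nsmul_eq_mul, ← mul_assoc]
  exact mul_le_mul_of_nonneg_right (mul_le_mul_of_nonneg_right (hF y) hF0) hc

/-- **(3.132) AT ONE CONFIGURATION FROM THE COMBES–THOMAS DATA ON THE INDEX** — `QGQInverse.inverse_decay` BY NAME on the index with the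
pulled-back pseudo-metric, read blockwise and un-normalised.  At a member whose (2.46)-distance is a pseudo-metric with `Lʲη ≧ 0`: if the
normalised matrix S of (QGQ\*)(U) on the index is coercive with γ and has (e^{κd(πa,πb)} − 1)-weighted absolute row∕column sums ≦ ρ < γ
(κ ≧ 0), the kernel is read blockwise (`InvNormalisedIdx` at U), the weights un-normalise with growth rate ε and constant A ≧ 0, and the
fibres have cardinality ≦ F, then `B9.Ineq3132 d K ((γ − ρ)⁻¹·F²·A) (κ − ε) U`:
|K(U)(y, y′)| ≦ (γ − ρ)⁻¹F²A·(L^jη)^{−2}(L^{j′}η)^{−d}e^{−(κ−ε)d(y,y′)} (the written repair's C₀ = 2n_𝔤L^{|d∕2−1|}∕γ pattern).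
[cite: Balaban1985BackgroundPropagators, (3.132) p.422; Balaban1984PropagatorsII, Lemma 2.1 (2.60) p.234] -/
theorem ineq3132_of_coercive_idx [DecidableEq n] (d : ℕ) (K : B9.SiteKernel g B) (U : B.Cfg) (π : n → g.Site)
    (S : Matrix n n ℝ) (w : g.Site → ℝ) {γ κ ρ ε A F : ℝ} (hργ : ρ < γ) (hκ : 0 ≤ κ) (hA : 0 ≤ A) (hS : Coercive S γ)
    (hsymm : ∀ y y' : g.Site, g.dist y y' = g.dist y' y) (hzero : ∀ y : g.Site, g.dist y y = 0)
    (htri : ∀ a b c : g.Site, g.dist a c ≤ g.dist a b + g.dist b c) (hlen : ∀ y : g.Site, 0 ≤ g.len y)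
    (hrow : ∀ a : n, ∑ b : n, |S a b| * (Real.exp (κ * g.dist (π a) (π b)) - 1) ≤ ρ)
    (hcol : ∀ b : n, ∑ a : n, |S a b| * (Real.exp (κ * g.dist (π a) (π b)) - 1) ≤ ρ)
    (hF : ∀ y : g.Site, (((Finset.univ.filter fun a : n => π a = y).card : ℕ) : ℝ) ≤ F)
    (hK : ∀ y y' : g.Site, |K.ker U y y'| ≤ w y * w y' *
      ∑ a ∈ Finset.univ.filter (fun a : n => π a = y), ∑ b ∈ Finset.univ.filter (fun b : n => π b = y'), |S⁻¹ a b|)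
    (hwt : WeightsTransfer g d w ε A) :
    B9.Ineq3132 d K ((γ - ρ)⁻¹ * F ^ 2 * A) (κ - ε) U := by
  intro y y'
  have hγρ : 0 ≤ (γ - ρ)⁻¹ := inv_nonneg.mpr (by linarith)
  -- Theorem A on the index with the pulled-back pseudo-metric
  have hinv : ∀ a b : n, |S⁻¹ a b| ≤ (γ - ρ)⁻¹ * Real.exp (-(κ * g.dist (π a) (π b))) :=
    inverse_decay S (fun a b => g.dist (π a) (π b)) hργ hκ hS (fun a b => hsymm (π a) (π b)) (fun a => hzero (π a))
      (fun a b c => htri (π a) (π b) (π c)) hrow hcol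
  -- the block over the two fibres
  set D : ℝ := (γ - ρ)⁻¹ * Real.exp (-(κ * g.dist y y')) with hD
  have hD0 : 0 ≤ D := mul_nonneg hγρ (Real.exp_nonneg _)
  have hblock : ∑ a ∈ Finset.univ.filter (fun a : n => π a = y), ∑ b ∈ Finset.univ.filter (fun b : n => π b = y'),
      |S⁻¹ a b| ≤ F * F * D := by
    refine fibre_double_sum_le π hF hD0 (fun a b => |S⁻¹ a b|) y y' fun a ha b hb => ?_
    have ha' : π a = y := (Finset.mem_filter.1 ha).2
    have hb' : π b = y' := (Finset.mem_filter.1 hb).2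
    have h := hinv a b
    rw [ha', hb'] at h
    exact h
  have hrhs : 0 ≤ A * Real.exp (ε * g.dist y y') * g.len y ^ (-(2 : ℝ)) * g.len y' ^ (-(d : ℝ)) :=
    mul_nonneg (mul_nonneg (mul_nonneg hA (Real.exp_nonneg _)) (Real.rpow_nonneg (hlen y) _))
      (Real.rpow_nonneg (hlen y') _)
  have hsum0 : 0 ≤ ∑ a ∈ Finset.univ.filter (fun a : n => π a = y), ∑ b ∈ Finset.univ.filter (fun b : n => π b = y'),
      |S⁻¹ a b| := Finset.sum_nonneg fun a _ => Finset.sum_nonneg fun b _ => abs_nonneg _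
  calc |K.ker U y y'| ≤ w y * w y' * ∑ a ∈ Finset.univ.filter (fun a : n => π a = y),
        ∑ b ∈ Finset.univ.filter (fun b : n => π b = y'), |S⁻¹ a b| := hK y y'
    _ ≤ (A * Real.exp (ε * g.dist y y') * g.len y ^ (-(2 : ℝ)) * g.len y' ^ (-(d : ℝ))) * (F * F * D) :=
        mul_le_mul (hwt y y') hblock hsum0 hrhs
    _ = (γ - ρ)⁻¹ * F ^ 2 * A * g.len y ^ (-(2 : ℝ)) * g.len y' ^ (-(d : ℝ)) *
          (Real.exp (ε * g.dist y y') * Real.exp (-(κ * g.dist y y'))) := by rw [hD]; ring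
    _ = (γ - ρ)⁻¹ * F ^ 2 * A * g.len y ^ (-(2 : ℝ)) * g.len y' ^ (-(d : ℝ)) *
          Real.exp (-((κ - ε) * g.dist y y')) := by rw [exp_growth_mul_decay]

end OneU

section FamilyRowSum

variable {I : Type} {geo : I → B9.Geometry} [∀ i, Fintype (geo i).Site] [∀ i, DecidableEq (geo i).Site]
  {nn : I → Type} [∀ i, Fintype (nn i)]

/-- **[4] (2.61) LIFTS TO THE INDEX**: if every member has row sums Σ_{y′} e^{−κd(y,y′)} ≦ c for M ≧ M_L (`RowSum261 geo`) and the fibres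
have cardinality ≦ F, the pulled-back family has Σ_b e^{−κd(πa,πb)} ≦ F·max(c, 0) for M ≧ M_L — `RowSum261` of the `geoComap` family.
[cite: Balaban1984PropagatorsII, Lemma 2.1 (2.61) p.234 (bookkeeping: the fibre count n_𝔤)] -/
theorem rowSum261_geoComap (π : ∀ i, nn i → (geo i).Site) {F : ℝ}
    (hF : ∀ (i : I) (y : (geo i).Site), (((Finset.univ.filter fun a : nn i => π i a = y).card : ℕ) : ℝ) ≤ F)
    (h : RowSum261 geo) : RowSum261 (fun i => geoComap (geo i) (π i)) := by
  intro κ hκ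
  obtain ⟨ML, c, H⟩ := h κ hκ
  refine ⟨ML, F * max c 0, fun i hM a => ?_⟩
  have hF0 : 0 ≤ F := le_trans (Nat.cast_nonneg _) (hF i (π i a))
  have hrow : ∑ y' : (geo i).Site, Real.exp (-(κ * (geo i).dist (π i a) y')) ≤ max c 0 := (H i hM (π i a)).trans (le_max_left _ _)
  calc ∑ b : nn i, Real.exp (-(κ * (geoComap (geo i) (π i)).dist a b))
      = ∑ b : nn i, Real.exp (-(κ * (geo i).dist (π i a) (π i b))) := rfl
    _ ≤ F * ∑ y' : (geo i).Site, Real.exp (-(κ * (geo i).dist (π i a) y')) :=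
        sum_comp_le_of_fibre (π i) (hF i) (fun y' => Real.exp (-(κ * (geo i).dist (π i a) y'))) fun _ => Real.exp_nonneg _
    _ ≤ F * max c 0 := mul_le_mul_of_nonneg_left hrow hF0

end FamilyRowSum

/-! ## §3 The whole printed leaf over any family, from the index data -/

section Family

variable {I : Type} {c35 : ℝ} {geo : I → B9.Geometry} {bg : I → B9.Backgrounds} [∀ i, DecidableEq (geo i).Site]
  {nn : I → Type} [∀ i, Fintype (nn i)] [∀ i, DecidableEq (nn i)]

/-- ★ **(3.132) AS THE WHOLE PRINTED LEAF `B9.Stmt3132Printed` FROM THE COMBES–THOMAS DATA ON THE INDEX** (matrix-valued kernels): over any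
family with a finite index `nn i` fibred over the coarse sites (`π i`, fibres ≦ F), the Combes–Thomas inputs `B9Eq3132Whole.CTInputs` for the
normalised matrices `S` of QGQ\* and `S₁` of QG₁Q\* ON THE INDEX (i.e. over the `geoComap` family), the blockwise dictionaries `InvNormalisedIdx`
for the two kernels, the weights transfer at every rate under an M-threshold with one A > 0, and the pseudo-metric ∕ sign facts of the
carrier give `B9.Stmt3132Printed d c35 geo bg QGQinv QG₁Qinv` with M₄″ := max(max M₄ M₄′, M_w), a₀″ := min a₀ a₀′, δ₁ := ½min κ κ′ and
O(1) := ((γ − ρ)⁻¹ + (γ′ − ρ′)⁻¹)·(F² + 1)·A.  Mechanism: `ineq3132_of_coercive_idx` at the common rate.  Nothing of print asserted; NOT a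
node discharge. [cite: Balaban1985BackgroundPropagators, (3.132) p.422 + Thm 3.12 p.423 (prefix); Balaban1984PropagatorsII, Lemma 2.1 (2.60)–(2.61) p.234] -/
theorem stmt3132Printed_of_coercive_idx (d : ℕ) {QGQinv QG₁Qinv : ∀ i, B9.SiteKernel (geo i) (bg i)}
    (π : ∀ i, nn i → (geo i).Site) {F : ℝ}
    (hF : ∀ (i : I) (y : (geo i).Site), (((Finset.univ.filter fun a : nn i => π i a = y).card : ℕ) : ℝ) ≤ F)
    {S S₁ : ∀ i, (bg i).Cfg → Matrix (nn i) (nn i) ℝ} {w w₁ : ∀ i, (geo i).Site → ℝ}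
    (hCT : CTInputs c35 (fun i => geoComap (geo i) (π i)) bg S) (hCT₁ : CTInputs c35 (fun i => geoComap (geo i) (π i)) bg S₁)
    (hN : ∀ i, InvNormalisedIdx (QGQinv i) (π i) (S i) (w i)) (hN₁ : ∀ i, InvNormalisedIdx (QG₁Qinv i) (π i) (S₁ i) (w₁ i))
    (hsymm : ∀ i (y y' : (geo i).Site), (geo i).dist y y' = (geo i).dist y' y)
    (hzero : ∀ i (y : (geo i).Site), (geo i).dist y y = 0)
    (htri : ∀ i (a b c : (geo i).Site), (geo i).dist a c ≤ (geo i).dist a b + (geo i).dist b c)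
    (hlen : ∀ i (y : (geo i).Site), 0 ≤ (geo i).len y) {A : ℝ} (hA : 0 < A)
    (hwt : ∀ ε : ℝ, 0 < ε → ∃ Mw : ℝ, ∀ i : I, Mw ≤ (geo i).M →
      WeightsTransfer (geo i) d (w i) ε A ∧ WeightsTransfer (geo i) d (w₁ i) ε A) :
    B9.Stmt3132Printed d c35 geo bg QGQinv QG₁Qinv := by
  obtain ⟨M₄, a₀, γ, ρ, κ, hM₄, ha₀, hργ, hκ, H⟩ := hCT
  obtain ⟨M₄', a₀', γ', ρ', κ', hM₄', ha₀', hργ', hκ', H'⟩ := hCT₁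
  -- d ≥ 0 from the pseudo-metric axioms
  have hdist : ∀ i (y y' : (geo i).Site), 0 ≤ (geo i).dist y y' := by
    intro i y y'
    have h := htri i y y' y
    rw [hzero i, hsymm i y' y] at h
    linarith
  -- common rate and transfer rate
  set κ₀ : ℝ := min κ κ' with hκ₀
  have hκ₀pos : 0 < κ₀ := lt_min hκ hκ'
  obtain ⟨Mw, Hw⟩ := hwt (κ₀ / 2) (by positivity)
  have hC : 0 ≤ (γ - ρ)⁻¹ := inv_nonneg.mpr (by linarith)
  have hC' : 0 ≤ (γ' - ρ')⁻¹ := inv_nonneg.mpr (by linarith)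
  have hF2 : F ^ 2 ≤ F ^ 2 + 1 := by linarith
  have hF21 : 0 ≤ F ^ 2 + 1 := by positivity
  refine ⟨max (max M₄ M₄') Mw, κ₀ / 2, min a₀ a₀', ((γ - ρ)⁻¹ + (γ' - ρ')⁻¹) * (F ^ 2 + 1) * A,
    lt_max_of_lt_left (lt_max_of_lt_left hM₄), by positivity, lt_min ha₀ ha₀', ?_, ?_⟩
  · have h1 : 0 < (γ - ρ)⁻¹ := inv_pos.mpr (by linarith)
    positivity
  · intro i hM α₀ hα₀ hMa U hU hU'
    have hM₄i : M₄ ≤ (geo i).M := le_trans (le_trans (le_max_left _ _) (le_max_left _ _)) hM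
    have hM₄i' : M₄' ≤ (geo i).M := le_trans (le_trans (le_max_right _ _) (le_max_left _ _)) hM
    have hMwi : Mw ≤ (geo i).M := le_trans (le_max_right _ _) hM
    obtain ⟨hco, hrow, hcol⟩ := H i hM₄i α₀ hα₀ (le_trans hMa (min_le_left _ _)) U hU hU'
    obtain ⟨hco', hrow', hcol'⟩ := H' i hM₄i' α₀ hα₀ (le_trans hMa (min_le_right _ _)) U hU hU'
    obtain ⟨hwtS, hwtS₁⟩ := Hw i hMwi
    -- weighted sums at the common rate κ₀ (the pulled-back distance is d(πa, πb) by `rfl`)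
    have hrow₀ : ∀ a, ∑ b, |S i U a b| * (Real.exp (κ₀ * (geo i).dist (π i a) (π i b)) - 1) ≤ ρ := fun a =>
      le_trans (Finset.sum_le_sum fun b _ => weighted_term_mono (hdist i (π i a) (π i b)) (min_le_left _ _)) (hrow a)
    have hcol₀ : ∀ b, ∑ a, |S i U a b| * (Real.exp (κ₀ * (geo i).dist (π i a) (π i b)) - 1) ≤ ρ := fun b =>
      le_trans (Finset.sum_le_sum fun a _ => weighted_term_mono (hdist i (π i a) (π i b)) (min_le_left _ _)) (hcol b)
    have hrow₀' : ∀ a, ∑ b, |S₁ i U a b| * (Real.exp (κ₀ * (geo i).dist (π i a) (π i b)) - 1) ≤ ρ' := fun a =>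
      le_trans (Finset.sum_le_sum fun b _ => weighted_term_mono (hdist i (π i a) (π i b)) (min_le_right _ _)) (hrow' a)
    have hcol₀' : ∀ b, ∑ a, |S₁ i U a b| * (Real.exp (κ₀ * (geo i).dist (π i a) (π i b)) - 1) ≤ ρ' := fun b =>
      le_trans (Finset.sum_le_sum fun a _ => weighted_term_mono (hdist i (π i a) (π i b)) (min_le_right _ _)) (hcol' b)
    -- the two displays at rate κ₀ − κ₀/2 = κ₀/2
    have e : κ₀ - κ₀ / 2 = κ₀ / 2 := by ring
    have h1 := ineq3132_of_coercive_idx d (QGQinv i) U (π i) (S i U) (w i) hργ hκ₀pos.le hA.le hco (hsymm i) (hzero i)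
      (htri i) (hlen i) hrow₀ hcol₀ (hF i) (hN i U) hwtS
    have h2 := ineq3132_of_coercive_idx d (QG₁Qinv i) U (π i) (S₁ i U) (w₁ i) hργ' hκ₀pos.le hA.le hco' (hsymm i)
      (hzero i) (htri i) (hlen i) hrow₀' hcol₀' (hF i) (hN₁ i U) hwtS₁
    rw [e] at h1 h2
    have hsum : 0 ≤ ((γ - ρ)⁻¹ + (γ' - ρ')⁻¹) * (F ^ 2 + 1) * A := mul_nonneg (mul_nonneg (add_nonneg hC hC') hF21) hA.le
    refine ⟨ineq3132_mono d (hlen i) (hdist i) h1 ?_ hsum le_rfl, ineq3132_mono d (hlen i) (hdist i) h2 ?_ hsum le_rfl⟩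
    · calc (γ - ρ)⁻¹ * F ^ 2 * A ≤ (γ - ρ)⁻¹ * (F ^ 2 + 1) * A :=
            mul_le_mul_of_nonneg_right (mul_le_mul_of_nonneg_left hF2 hC) hA.le
        _ ≤ ((γ - ρ)⁻¹ + (γ' - ρ')⁻¹) * (F ^ 2 + 1) * A :=
            mul_le_mul_of_nonneg_right (mul_le_mul_of_nonneg_right (le_add_of_nonneg_right hC') hF21) hA.le
    · calc (γ' - ρ')⁻¹ * F ^ 2 * A ≤ (γ' - ρ')⁻¹ * (F ^ 2 + 1) * A :=
            mul_le_mul_of_nonneg_right (mul_le_mul_of_nonneg_left hF2 hC') hA.le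
        _ ≤ ((γ - ρ)⁻¹ + (γ' - ρ')⁻¹) * (F ^ 2 + 1) * A :=
            mul_le_mul_of_nonneg_right (mul_le_mul_of_nonneg_right (le_add_of_nonneg_left hC) hF21) hA.le

end Family

/-! ## §4 At the record geometry `geo9Y`, symmetric normalisation: six located binders and the fibre bound -/

section Record

open B9PinMembersKLevelV1 (MemberY geo9Y)
open B9GeoLemma21KLevelV1 (rowSum261_geo9Y geo9Y_dist_comm geo9K_dist_nonneg' geo9Y_dist_self geo9Y_dist_triangle
  geo9Y_len_pos hwt_symm_geo9Y symmA_pos)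

variable {d ℓ : ℕ} {hd : 1 ≤ d + 1} {hL : Odd (ℓ + 1) ∧ 1 < ℓ + 1} {b₀ b₁ : ℝ} {Mstar : ℕ}

/-- ★ **ROW 26 AT THE RECORD GEOMETRY FOR MATRIX-VALUED KERNELS** (the shape def-Y's M_N(ℂ)-valued letters produce; symmetric normalisation
`w(y) = (Lʲη)^{−(1+d′∕2)}`): over the members `MemberY` with their realised geometry `geo9Y` (ANY backgrounds record `bg`, `c35`, kernels, ANY
finite index `nn x` fibred over the coarse sites by `π x` with fibres ≦ F, ANY instances as the knit binds them), `CoerciveUnder` and `DecayUnder`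
for the normalised matrices `S`, `S₁` ON THE INDEX (the `geoComap` family) and the blockwise dictionaries `InvNormalisedIdx` ×2 give
`B9.Stmt3132Printed d′ c35 geo9Y bg QGQinv QG₁Qinv`.  Discharged here: d ≧ 0 ∕ symmetric on the index (`geo9K_dist_nonneg'`, `geo9Y_dist_comm`),
(2.61) on the index (`rowSum261_geoComap` over `rowSum261_geo9Y`), the carrier facts, the weights transfer (`hwt_symm_geo9Y d′`, A = L^{|(d′−2)∕2|},
`symmA_pos`).  In the N06 knit: `s3132 := stmt3132Printed_geo9Y_of_coercive_decay_idx (θ₃.d₆+1) π hF hco hdec hco₁ hdec₁ hN hN₁`.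
[cite: Balaban1985BackgroundPropagators, (3.132) p.422 + Thm 3.12 p.423 (prefix); Balaban1984PropagatorsII, Lemma 2.1 (2.60)–(2.61) p.234] -/
theorem stmt3132Printed_geo9Y_of_coercive_decay_idx (dd : ℕ) [∀ x : MemberY d ℓ hd hL b₀ b₁ Mstar, Fintype (geo9Y x).Site]
    [∀ x : MemberY d ℓ hd hL b₀ b₁ Mstar, DecidableEq (geo9Y x).Site] {c35 : ℝ}
    {bg : MemberY d ℓ hd hL b₀ b₁ Mstar → B9.Backgrounds}
    {QGQinv QG₁Qinv : ∀ x : MemberY d ℓ hd hL b₀ b₁ Mstar, B9.SiteKernel (geo9Y x) (bg x)}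
    {nn : MemberY d ℓ hd hL b₀ b₁ Mstar → Type} [∀ x, Fintype (nn x)] [∀ x, DecidableEq (nn x)]
    (π : ∀ x : MemberY d ℓ hd hL b₀ b₁ Mstar, nn x → (geo9Y x).Site) {F : ℝ}
    (hF : ∀ (x : MemberY d ℓ hd hL b₀ b₁ Mstar) (y : (geo9Y x).Site),
      (((Finset.univ.filter fun a : nn x => π x a = y).card : ℕ) : ℝ) ≤ F)
    {S S₁ : ∀ x : MemberY d ℓ hd hL b₀ b₁ Mstar, (bg x).Cfg → Matrix (nn x) (nn x) ℝ}
    (hco : CoerciveUnder c35 (fun x => geoComap (geo9Y x) (π x)) bg S)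
    (hdec : DecayUnder c35 (fun x => geoComap (geo9Y x) (π x)) bg S)
    (hco₁ : CoerciveUnder c35 (fun x => geoComap (geo9Y x) (π x)) bg S₁)
    (hdec₁ : DecayUnder c35 (fun x => geoComap (geo9Y x) (π x)) bg S₁)
    (hN : ∀ x : MemberY d ℓ hd hL b₀ b₁ Mstar,
      InvNormalisedIdx (QGQinv x) (π x) (S x) (fun y => (geo9Y x).len y ^ (-(1 + (dd : ℝ) / 2))))
    (hN₁ : ∀ x : MemberY d ℓ hd hL b₀ b₁ Mstar,
      InvNormalisedIdx (QG₁Qinv x) (π x) (S₁ x) (fun y => (geo9Y x).len y ^ (-(1 + (dd : ℝ) / 2)))) :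
    B9.Stmt3132Printed dd c35 (geo9Y (d := d) (ℓ := ℓ) (hd := hd) (hL := hL) (b₀ := b₀) (b₁ := b₁) (Mstar := Mstar)) bg
      QGQinv QG₁Qinv := by
  have hdist : ∀ (x : MemberY d ℓ hd hL b₀ b₁ Mstar) (a b : nn x),
      0 ≤ (geoComap (geo9Y x) (π x)).dist a b := fun x a b => geo9K_dist_nonneg' x.toKIdx (π x a) (π x b)
  have hsymm : ∀ (x : MemberY d ℓ hd hL b₀ b₁ Mstar) (a b : nn x),
      (geoComap (geo9Y x) (π x)).dist a b = (geoComap (geo9Y x) (π x)).dist b a :=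
    fun x a b => geo9Y_dist_comm x (π x a) (π x b)
  have h261 : RowSum261 (fun x : MemberY d ℓ hd hL b₀ b₁ Mstar => geoComap (geo9Y x) (π x)) :=
    rowSum261_geoComap π hF rowSum261_geo9Y
  exact stmt3132Printed_of_coercive_idx dd π hF (ctInputs_of_coercive_decay hdist hsymm h261 hco hdec)
    (ctInputs_of_coercive_decay hdist hsymm h261 hco₁ hdec₁) hN hN₁ (fun x y y' => geo9Y_dist_comm x y y')
    (fun x y => geo9Y_dist_self x y) (fun x a b c => geo9Y_dist_triangle x a b c) (fun x y => (geo9Y_len_pos x y).le)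
    (symmA_pos dd) (hwt_symm_geo9Y (d := d) (ℓ := ℓ) (hd := hd) (hL := hL) (b₀ := b₀) (b₁ := b₁) (Mstar := Mstar) dd)

end Record

end

end Literature.MathematicalPhysics.QuantumFieldTheory.Balaban1983to89.B9Eq3132ScalarIndex
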